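import Mathlib
import HarnessLib
import HarnessLib.Audit
import Summits.RiemannHypothesis.Statement
import Literature.NumberTheory.LFunctions.ZetaScrew
import Literature.NumberTheory.LFunctions.GeneralizedRH
import HarnessLib.Audit.Status.Attr

/-!
Route: ScrewQuarticNodes

# Route ScrewQuarticNodes — Nyquist-3/4 sparse-node screw door — positivity of Ψ at x = j⁴ detects
RH

D-0145 LINE (seat rh-idea-9, technique ASSUME-THE-OPPOSITE; screw column S/X, bears_on R0 splitting
search and the door family of
IntegerScrew.DiscreteLandau = stmt-RiemannHypothesis-15758). It suffices to show X = SparseNodeDoor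
∧ QuarticNodePositivity (with the
provable-now support QuarticNodesDense). SparseNodeDoor (RH-FREE, the attacked conjunct): for every
K > 0 and every node set N ⊂ ℝ that
meets every interval [a, a + √(K/(e^{(a+2)/2}+1))] for large a (NYQUIST GAP ≍ √K·e^{−a/4}, i.e.
x-gaps ≍ x^{3/4} in x = e^a), the one-sided
node bound Ψ ≥ −K on N (Ψ = zetaScrew, Suzuki2023 (1.1)) implies RH. The minimal-counterexample
portrait behind it: an off-line zero forces
a negative excursion of Ψ below −2K (robust Landau, contrapositive), and PRIME-SIDE SEMICONCAVITY (Ψ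
= C²-archimedean − convex prime hinge
sum, modulus e^{t/2}+1) forces that excursion to stay below −K on a one-sided window of length
√K·e^{−t/4} — so it cannot hide between
nodes of that gap. QuarticNodePositivity (Ψ(4 log j) ≥ 0 for all j ≥ 1, i.e. positivity at x = j⁴)
is the DECLARED RESIDUAL
(RH-EQUIVALENT·DERIVED: ⟸ RH by Suzuki Thm 1.7; ⟹ RH by the door), a refutation-budget object for
the IntegerScrew node instruments,
never a proving target. No summit is proved by a line. Nothing here bears on the truth of RH.
Lean: `SparseNodeDoor ∧ QuarticNodesDense ∧ QuarticNodePositivity`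

## Assembly
Pure logic (sorry-free in Sketch.lean and glue.lean): `closes (hA : SparseNodeDoor) (hN :
QuarticNodesDense) (hR : QuarticNodePositivity) :
Summit.RiemannHypothesis` applies the door with K = 100 and N = {4·log j : j ≥ 1}; density from hN,
node bounds −100 ≤ 0 ≤ Ψ from hR.
Every binder is consumed; SparseNodeDoor is the attacked conjunct, QuarticNodePositivity the named
residual.

Rationale: WHY THIS LINE. The tree's discrete door `IntegerScrew.DiscreteLandau` (Ψ(log m) ≥ 0 for ALL m ≥ 1 ⇒
RH; proved, Theorems/IntegerScrewDiscreteLandau.lean)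
samples Ψ at x-gap 1 and uses cell-wise MONOTONICITY (node slack 6); the geometric lattice of the
screw-bridge column (x-gap ≍ x) is
provably blind in the zero-side class (B16, ScrewLatticeWolffModel.exists_blind_model). This line
locates the threshold between them:
assuming ¬RH, a counterexample's negative excursion has depth ≥ 2K somewhere late (Landau,
MontgomeryVaughan2007 §15.1) and — new lever —
WIDTH ≥ √K·e^{−t/4} by the second-order structure of Suzuki's explicit formula (Suzuki2023 (1.1):
the only non-smooth part of Ψ is the
convex hinge sum Σ Λ(n)n^{−1/2}(t−log n)₊, so Ψ(t) ≤ Ψ(t₀) + p(t−t₀) + ½(e^{max/2}+1)(t−t₀)²). Hence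
x^{3/4}-dense one-sided sampling
detects RH; the quartic nodes x = j⁴ are such a set (K = 100). Imported: one-sided Tauberian theory
(Landau) + elementary convex analysis;
no prior route or negatives entry (4, unrelated) types a sampling-density law for a one-sided RH
criterion, and the exponent 3/4 is
claimed sharp in the positivity class (a nonnegative mock Λ̃ with identical values on any sparser
node set and ψ̃ − x = Ω(x^{σ₁}) exists by
two-moment matching per window — recorded in NOTES, not filed).

RANKED CRUXES. #2 SparseNodeDoor (crux) — RH-FREE NYQUIST DOOR: for every K > 0 and node set N
meeting every [a, a + √(K/(e^{(a+2)/2}+1))] for a ≥ T₀, if Ψ(x) ≥ −K for all x ∈ N then the Riemann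
hypothesis holds. [difficulty: M] (why it might fail: Only if the semiconcavity modulus of Ψ on
[t₀−1,t₀+1] exceeded e^{(t₀+2)/2}+1: the Hurwitz–Lerch term −¼e^{−t/2}Φ(e^{−2t},2,¼) must be concave
on (0,∞) and the kink bookkeeping at prime powers one-sided; else size (M: Taylor + robustLandau
glue).) [Suzuki2023, MontgomeryVaughan2007, doi:10.1007/bf01949062]
#7 QuarticNodePositivity (crux) — DECLARED RESIDUAL (RH-EQUIVALENT·DERIVED; refutation budget only):
Ψ(4·log j) ≥ 0 for every integer j ≥ 1, i.e. Suzuki's screw function is non-negative at the quartic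
nodes x = j⁴. ⟸ RH (Suzuki2023 Thm 1.7, tree zetaScrew_nonneg_of_RH); ⟹ RH by SparseNodeDoor +
QuarticNodesDense. Instrument: the IntegerScrew node certificates (zetaScrew_log_two_pos,
IntegerScrewRungFour.zetaScrew_log_four_sub_bounds, screwPivot ladder ⇒ Ψ(log M) > 0) restricted to
M = j⁴; one certified negative node refutes it and RH. [deps: SparseNodeDoor] [difficulty:
open-problem] (why it might fail: It is equivalent to RH given the door: fails iff ζ has an off-line
zero, whose forced excursion (depth 200, width 10·e^{−t/4}) eventually covers a node 4·log j; nobody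
is asked to prove it — a certified Ψ(log j⁴) < 0 would refute RH.) [Suzuki2023, arXiv:2209.12349]
#9 QuarticNodesDense (support) — provable-now real analysis: the quartic nodes 4·log j meet every
interval [a, a + √(100/(e^{(a+2)/2}+1))] for large a (gap 4·log(1+1/j) ≤ 4e^{−a/4} <
10e^{−1/2}e^{−a/4}/√2). [difficulty: provable-now] [Suzuki2023]

TWO-LAYER PLAN. SparseNodeDoor ⇐ stub_tailFloor (Nyquist step, uses stub_semiconcave) →
stub_compactFloor (continuity on [0,T₁]) → stub_landauRH (tree
robustLandau + quasiRiemannHypothesis_one_half_iff_holds) → SparseNodeDoor — the registered BC3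
skeleton bc/SparseNodeDoor_birth.lean
(composition SparseNodeDoor_of kernel-checked, 4 sorries = 4 stubs).

KILL CRITERIA. A certified node with Ψ(4·log j) < 0 refutes QuarticNodePositivity (and RH): close
refuted:QuarticNodePositivity — that is the
residual failing (¬RH detected), not a defect of the line. The semiconcavity modulus is SETTLED and
exact (critic price paid 2026-08-27,
check files semiconcave_check.py d7db531653daa14a / semiconcave_result.txt 0976cb3b70538f9d under
pub/ideators/rh-idea-9/): the smooth part
of Ψ has S''(t) = e^{t/2} − e^{−5t/2}/(1−e^{−2t}) < e^{t/2} for t > 0, below the filed modulus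
e^{max/2}+1. Should any bookkeeping step
nevertheless demand a larger modulus or a smaller gap constant, that is a NODE-LAW REPAIR of
misstatement type (K ↦ larger K, or the
constant inside √(K/(e^{(a+2)/2}+1)); repaired item SparseNodeDoorR), NOT a kill. The line is killed
only if the Nyquist step fails for
SOME admissible N at EVERY constant (one-sided excursions of bounded depth with width o(e^{−t/4})),
or if DiscreteLandau-type doors are
shown to need x-gap o(x^{3/4}).

NOT DECOMPOSED YET. The sharpness half (mock nonnegative Λ̃ with the same node values on any node
set of gap ≥ C·x^{3/4+δ} and ψ̃ − x = Ω±(x^{σ₁})) is a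
barrier note, not an item; effective excursion constants (Knapowski–Turán / Kaczorowski–Pintz
localisation in every [Y^{1−ε},Y]) are
layer-2 children of SparseNodeDoor if wanted; the compact-interval floor and the strip→RH glue are
stubs, not items.

CHEAPEST FALSIFIER. DONE 2026-08-27: the identity (2k+½)² = 4(k+¼)² collapses the Hurwitz–Lerch
second derivative to
4e^{−t/2}/(1−e^{−2t}), so S'' = e^{t/2} − e^{−5t/2}/(1−e^{−2t}) < e^{t/2} (t > 0) and the Lerch term
is concave as claimed; numeric
one-sided Taylor test with modulus e^{max/2}: 0 violations on 160 040 pairs (t₀ ∈ [0.2,9.3]). Base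
point t₀ = 0 is excluded in the
skeleton (Ψ'(0+) = +∞). Remaining cheapest check for a refuter: the kink bookkeeping (φ-part C²,
prime hinge sum convex, kinks one-sided)
read off zetaScrew_def — minutes.

NUMBERS. Node gap of x = j⁴ in t = log x: 4·log(1+1/j) ≤ 4e^{−t/4}; admissible Nyquist gap
√(K/(e^{(t+2)/2}+1)) ≥ √(K/2)·e^{−1/2}·e^{−t/4} =
4.29·e^{−t/4} at K = 100 (3.43 at K = 64, too small). DiscreteLandau: x-gap 1, slack K = 6.
Geometric lattice kh: x-gap ≍ x (blind, B16).
Width law: an excursion of depth 2K at t₀ keeps Ψ < −K on a one-sided window of length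
√(2K/(e^{(t₀+1)/2}+1)).

DEFINITION REQUESTS. None.

Novelty: Searches (2026-08-27): lean search 'zetaScrew (Real.log' / 'robustLandau' / 'NyquistFloor' (tree:
DiscreteLandau, robustLandau,
ScrewManifestCert NyquistFloor — a certificate-height law, different object); ledger negatives (4,
unrelated); lit search --hybrid
"one-sided oscillation theorem exceptional set Landau lemma" (10 docs, none relevant); lit search
"Kaczorowski Pintz oscillatory
properties arithmetical functions" ([corpus:paper:doi-10-1007-bf01951008 p.2] KP II: sign changes
with oscillation x^{θ−ε} in every
[Y^{1−ε},Y]); lit galaxy search "screw function|Kreĭn–Langer|negative definite kernel zeta" --star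
all (21 rows, no mathematical hit);
lit galaxy search "comparative prime-number theory|Knapowski and Tur|one-sided theorem of Landau"
--star panama ([galaxy:panama:297143017406558]
Ellison, Prime Numbers — Landau's one-sided theorem; [galaxy:panama:515593644015668] Knopfmacher —
Beurling-type systems).
Nearest prior art found: tree stmt-RiemannHypothesis-15758 IntegerScrew.DiscreteLandau (all integer
nodes, monotone cell slack); Suzuki2023
Thm 1.7 (continuous positivity criterion); doi:10.1007/bf01949062 / doi:10.1007/bf01951008
(Kaczorowski–Pintz: localisation of two-sided
oscillations in [Y^{1−ε},Y], no sampling statement); MontgomeryVaughan2007 §15.1 (Landau).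
Delta: a sampling-density (Nyquist) law for a ONE-SIDED RH criterion — x^{3/4}-dense node positivity
of Ψ detects RH — obtained by
coupling Landau's lemma with the prime-side semiconcavity of Suzuki's explicit  [refs: 10.1007/bf01949062, 10.1007/bf01951008, paper:doi-10-1007-bf01951008, doi:10.1007/bf01949062, doi:10.1007/bf01951008, Suzuki2023, MontgomeryVaughan2007]

Barriers (technique_class: one-sided-landau, prime-side-semiconcavity, sampling-door): - technique_class: one-sided-landau, prime-side-semiconcavity, sampling-door
- Literature.Barriers.RiemannHypothesis.LittlewoodOscillation: outside — the one-sided reader is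
Suzuki's ½-shifted, archimedean-corrected Ψ whose positivity is RH-EQUIVALENT (tree
Suzuki2023_thm17_holds), not ψ(x)−x ≥ −C√x (unsound by Littlewood); the door's hypothesis Ψ ≥ −K at
nodes is RH-implied, so Littlewood's Ω± never refutes it under RH.
- Literature.Barriers.RiemannHypothesis.DiamondMontgomeryVorhauer2006_thm1
(BeurlingCounterexamples): the door is a detection theorem about ζ itself (its Laplace transform's
poles are ζ's zeros); the barrier bites only attempts to PROVE the residual from prime-counting
axioms — the residual is declared RH-equivalent·derived and never staffed; the sharpness note (mock
Λ̃ blindness beyond gap x^{3/4}) is this barrier's sampling form.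
- Literature.Barriers.RiemannHypothesis.LiouvilleSignConjectures: one-signedness conjectures (Pólya,
Turán) failed independently of RH; here node positivity is implied by RH (Thm 1.7) and implies it
(door), so it has no failure mode separate from ¬RH.
- Literature.Barriers.RiemannHypothesis.TuranPartialSums: not in class — no partial sums of
Dirichlet series are asserted one-signed.
- Negatives index: 4 refuted statements (ShiftedResolvent ×2, CharacterSums Conrey positivity,
UniversalFactor Laplace loophole) — none concerns Ψ, sampling, or Landau doors; empty intersection
at filing.

sub-problem: RiemannHypothesis · status: draft · opened planner-rh-idea-9-g0-0 2026-08-27T20:35:06Z · rev 2 · ledger route-RiemannHypothesis-ScrewQuarticNodes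
GENERATED by the gate from the ledger (D-0016/17). Provers cite these decls: `theorem foo : Summit.RiemannHypothesis.RiemannHypothesis.Theses.ScrewQuarticNodes.<Decl> := …` in Summits/RiemannHypothesis/RiemannHypothesis/Theorems/<Name>.lean.
-/

namespace Summit.RiemannHypothesis.RiemannHypothesis.Theses.ScrewQuarticNodes

open scoped BigOperators Topology Manifold Classical MeasureTheory ProbabilityTheory Matrix InnerProductSpace ComplexConjugate ContinuousMap
open Filter Set Function TopologicalSpace MeasureTheory

attribute [summit_statement] _root_.Summit.RiemannHypothesis

open Summit

/-- item stmt-RiemannHypothesis-22169 · crux · rank 2 · closed · proved by Summit.RiemannHypothesis.RiemannHypothesis.Theorems.ScrewQuarticNodesSparseNodeDoor.sparseNodeDoor_proof (prover) · by planner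
why it might fail: Only if the semiconcavity modulus of Ψ on [t₀−1,t₀+1] exceeded e^{(t₀+2)/2}+1: the Hurwitz–Lerch term −¼e^{−t/2}Φ(e^{−2t},2,¼) must be concave on (0,∞) and the kink bookkeeping at prime powers one-sided; else size (M: Taylor + robustLandau glue).
sources: Suzuki2023, MontgomeryVaughan2007, doi:10.1007/bf01949062
[crux] RH-FREE NYQUIST DOOR: for every K > 0 and node set N meeting every [a, a +
√(K/(e^{(a+2)/2}+1))] for a ≥ T₀, if Ψ(x) ≥ −K for all x ∈ N then the Riemann hypothesis holds.
[difficulty: M] -/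
@[route_item "route-RiemannHypothesis-ScrewQuarticNodes", crux]
def SparseNodeDoor : Prop :=
  ∀ (K : ℝ) (N : Set ℝ), 0 < K → (∃ T₀ : ℝ, ∀ a : ℝ, T₀ ≤ a → ∃ x ∈ N, a ≤ x ∧ x ≤ a + Real.sqrt (K / (Real.exp ((a + 2) / 2) + 1))) → (∀ x ∈ N, -K ≤ Literature.NumberTheory.LFunctions.zetaScrew x) → _root_.RiemannHypothesis

-- `SparseNodeDoor` holds: proved by `Summit.RiemannHypothesis.RiemannHypothesis.Theorems.ScrewQuarticNodesSparseNodeDoor.sparseNodeDoor_proof` (its module imports this route file, so no `_holds` link can be stated here).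

/-- item stmt-RiemannHypothesis-22170 · crux · rank 7 · open · by planner
why it might fail: It is equivalent to RH given the door: fails iff ζ has an off-line zero, whose forced excursion (depth 200, width 10·e^{−t/4}) eventually covers a node 4·log j; nobody is asked to prove it — a certified Ψ(log j⁴) < 0 would refute RH.
sources: Suzuki2023, arXiv:2209.12349
[crux] DECLARED RESIDUAL (RH-EQUIVALENT·DERIVED; refutation budget only): Ψ(4·log j) ≥ 0 for every
integer j ≥ 1, i.e. Suzuki's screw function is non-negative at the quartic nodes x = j⁴. ⟸ RH
(Suzuki2023 Thm 1.7, tree zetaScrew_nonneg_of_RH); ⟹ RH by SparseNodeDoor + QuarticNodesDense.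
Instrument: the IntegerScrew node certificates (zetaScrew_log_two_pos,
IntegerScrewRungFour.zetaScrew_log_four_sub_bounds, screwPivot ladder ⇒ Ψ(log M) > 0) restricted to
M = j⁴; one certified negative node refutes it and RH. [deps: SparseNodeDoor] [difficulty:
open-problem] -/
@[route_item "route-RiemannHypothesis-ScrewQuarticNodes", crux]
def QuarticNodePositivity : Prop :=
  ∀ j : ℕ, 1 ≤ j → 0 ≤ Literature.NumberTheory.LFunctions.zetaScrew (4 * Real.log j)

/-- item stmt-RiemannHypothesis-22171 · support · rank 9 · closed · proved by Summit.RiemannHypothesis.RiemannHypothesis.Theorems.ScrewQuarticNodes.quarticNodesDense_proof (prover) · by planner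
sources: Suzuki2023
[support] provable-now real analysis: the quartic nodes 4·log j meet every interval [a, a +
√(100/(e^{(a+2)/2}+1))] for large a (gap 4·log(1+1/j) ≤ 4e^{−a/4} < 10e^{−1/2}e^{−a/4}/√2).
[difficulty: provable-now] -/
@[route_item "route-RiemannHypothesis-ScrewQuarticNodes", crux]
def QuarticNodesDense : Prop :=
  ∃ T₀ : ℝ, ∀ a : ℝ, T₀ ≤ a → ∃ j : ℕ, 1 ≤ j ∧ a ≤ 4 * Real.log j ∧ 4 * Real.log j ≤ a + Real.sqrt (100 / (Real.exp ((a + 2) / 2) + 1))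

-- `QuarticNodesDense` holds: proved by `Summit.RiemannHypothesis.RiemannHypothesis.Theorems.ScrewQuarticNodes.quarticNodesDense_proof` (its module imports this route file, so no `_holds` link can be stated here).

/-- item stmt-RiemannHypothesis-22172 · assembly · rank 1 · closed · proved by Summit.RiemannHypothesis.RiemannHypothesis.Theorems.ScrewQuarticNodes.assembly_proof (prover) · by planner
sources: Suzuki2023
[assembly] SparseNodeDoor → QuarticNodesDense → QuarticNodePositivity → RH (pure logic; `closes` in
glue.lean). -/
@[route_item "route-RiemannHypothesis-ScrewQuarticNodes"]
def Assembly : Prop :=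
  SparseNodeDoor → QuarticNodesDense → QuarticNodePositivity → Summit.RiemannHypothesis

-- `Assembly` holds: proved by `Summit.RiemannHypothesis.RiemannHypothesis.Theorems.ScrewQuarticNodes.assembly_proof` (its module imports this route file, so no `_holds` link can be stated here).

/-! D-0027 §2.1 — DECIDING THEOREM (planner-authored via `route open/edit --closes-file`; by planner-rh-idea-9-g0-0 2026-08-27T20:35:06Z):
its hypotheses are this route's items and its conclusion the sub-problem Statement (glue_lint), and it elaborates with this file. -/

@[closes "route-RiemannHypothesis-ScrewQuarticNodes"] theorem closes (hA : SparseNodeDoor) (hN : QuarticNodesDense) (hR : QuarticNodePositivity) : Summit.RiemannHypothesis := by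
  show _root_.RiemannHypothesis
  refine hA 100 {x : ℝ | ∃ j : ℕ, 1 ≤ j ∧ x = 4 * Real.log j} (by norm_num) ?_ ?_
  · obtain ⟨T₀, hT⟩ := hN
    refine ⟨T₀, fun a ha => ?_⟩
    obtain ⟨j, hj, h1, h2⟩ := hT a ha
    exact ⟨4 * Real.log j, ⟨j, hj, rfl⟩, h1, h2⟩
  · rintro x ⟨j, hj, rfl⟩
    have := hR j hj
    linarith

end Summit.RiemannHypothesis.RiemannHypothesis.Theses.ScrewQuarticNodes
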